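import Literature.Analysis.FluidPDE.KNSSRegularity
import HarnessLib

/-!
# KNSS 2009, §4 on a finite time window: regularity of bounded weak solutions of Navier–Stokes
# in `ℝ³ × (0, T)`, as printed (named fact)

Analysis/FluidPDE facts file on the discharge path of
`Literature.Analysis.FluidPDE.KNSS2009_regularity_boundedWeak_ancient` (`KNSSRegularity`), the
*ancient* (`ℝ³ × (−∞, 0)`, constants uniform in time) form of the regularity theory of
Koch–Nadirashvili–Seregin–Šverák, Acta Math. 203 (2009) = arXiv:0709.3599, §4, in which the proof
of their Theorem 5.2 consumes it ("By the results of Section 4, we have `|∇ᵏₓu| ≤ C_k` in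
`ℝ³ × (−∞, 0)`", first sentence of the proof). Section 4 itself is written for bounded weak
solutions on a **finite window** `ℝⁿ × (0, T)`, with constants `C(k, δ, T, M)` on `ℝⁿ × (δ, T)`;
the ancient form follows from it by time translation, uniformity of the constants and a gluing of
the decompositions `u = v + w + b(t)` of overlapping windows (an argument the source leaves to the
reader). This file vendors the finite-window statement, for `n = 3`, in exactly the elementary
rendering of the ancient fact (everywhere-defined representative `U` of `u − b`, classical spatial
derivatives, the vorticity equation in time-integrated form), so that

* the ancient fact is *reduced* to the printed one by a proof in the tree
  (`KNSS2009_regularity_boundedWeak_ancient_of_window`, file `KNSSRegularityAncient`), and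
* the printed one can in turn be attacked through its printed ingredients (Lemma 3.1; the linear
  estimates (3.10)–(3.14); Proposition 4.1; the vorticity bootstrap (4.7)–(4.10)), each a theory
  of its own (Oseen kernel, heat semigroup on `L^∞`, parabolic Calderón–Zygmund estimates), none
  of which is in Mathlib or the tree.

Nothing is proved in this file.

## The printed statement (arXiv:0709.3599v1, §4, the paragraph "We now turn to regularity
## properties of bounded weak solutions" to the end of the section)

"Let `u ∈ L^∞(ℝⁿ × (0, T))` be a weak solution of (4.1) in `ℝⁿ × (0, T)`, and let
`M = ‖u‖_{L^∞}`. Let `v` be the mild solution of the linear Cauchy problem (3.1) and (3.2) with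
`f_k = −u_k u` and `u₀ = 0`. By Lemma 3.1 we can write `u = v + w + b` with the `L^∞`-norms of
`v`, `w` and `b` bounded by `N = C₁(T)M² + C₂(T)M`, `w_t − Δw = 0` and `b` is a function of `t`
only. Hence for `k = 0, 1, 2, …` and `δ > 0` the derivatives `∇ᵏₓ(w + b)` are bounded by
`C(k, δ)N` in `ℝⁿ × (δ, T)` by Proposition 4.1. […] (4.7) `‖ω‖_{L^p(Q(z₀,R))} ≤ C(p, δ, R, M)`.
[…] For `n = 3` the equation for `ω` is (4.8) `ω_{i,t} − Δω_i = ∂_j(ω_j u_i − ω_i u_j)` and it is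
easy to check that in our situation this equation is satisfied in the sense of distributions.
[…] (4.9) `‖∇ᵏₓu‖_{L^p(Q(z₀,R))} ≤ C(k, δ, R, M)` […] (4.10)
`‖∇ᵏₓu‖_{L^∞(ℝⁿ × (δ, T))} ≤ C(k, δ, T, M)`. Finally, using (3.14) we also obtain for
`k = 0, 1, 2, …` (4.11) `‖∇ᵏₓ∂ₜ(u − b)‖_{L^∞(ℝⁿ × (δ, T))} ≤ C(k, δ, R, M)`." Here Lemma 3.1
(§3) provides `b` "a bounded measurable `ℝⁿ`-valued function on `(0, T)`" with (3.18)
`‖b‖_{L^∞(0,T)} ≤ C(T)‖u‖_{L^∞}`, determined up to a constant (Remark 3.1).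

**Equation numbers** in this file are those of the arXiv source (v1, the only version; displays
counted as LaTeX numbers them). The companion file `KNSSRegularity` refers to the same displays
as "(4.5)" (vorticity equation, here (4.8)), "(4.6)–(4.7)" (here (4.9)–(4.10)) and "(4.8)" (here
(4.11)).

## Rendering (identical to the ancient fact, clause by clause)

* `u = v + w + b` in `L^∞(ℝ³ × (0, T))` becomes: `u(t, ·) = U(t, ·) + b(t)` a.e. in `x` for a.e.
  `t ∈ (0, T)`, for a representative `U : ℝ → ℝ³ → ℝ³` of `v + w` which is jointly measurable,
  with every slice `U(t, ·)`, `0 < t < T`, smooth and divergence free (by (4.10)–(4.11) the class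
  `v + w` has a representative continuous on `ℝ³ × (δ, T)` together with all its spatial
  derivatives, for every `δ > 0`; these agree on overlaps, and `div u = 0` in distributions passes
  to every slice by continuity), and `b` measurable with `‖b(t)‖ ≤ N` for every `t` (a
  representative of the `L^∞(0, T)` class of Lemma 3.1, extended by `0`).
* (4.10): `‖∇ᵏₓU(t, x)‖ ≤ C(k, δ)` on `ℝ³ × (δ, T)` (classical `iteratedFDeriv`; `∇ₓ` does not see
  `b`, and for `k = 0` the bound is that on `v + w`).
* (4.11): `∇ᵏₓU` is Lipschitz in `t` on `(δ, T)`, uniformly in `x`, with constant `L(k, δ)`, for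
  every `k ≥ 0` (on a single window `b` is one fixed function, so order `0` is included; the
  ancient fact drops order `0` only because of the gluing).
* (4.8) with `u = U + b`, `div U = 0`, `div ω = 0`:
  `ωₜ = Δω − (u·∇)ω + (ω·∇)u = Δω − Dω[U + b] + DU[ω]`, integrated in time at each `x`, for
  `0 < s ≤ t < T` (equivalent to the distributional equation given (4.10)–(4.11)).
* Constants: KNSS's `C(k, δ, T, M)` (and `N = N(T, M)`) are rendered by quantifying
  `∀ M T, ∃ C L N, ∀ u` with `‖u‖ ≤ M` on the window — the uniformity that the ancient form needs.
  The window is `(0, T)` as printed; other windows follow by time translation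
  (`IsBoundedWeakNSSolutionOn.comp_add_right`, file `KNSSRegularityGluing`).

## References

* G. Koch, N. Nadirashvili, G. Seregin, V. Šverák, *Liouville theorems for the Navier–Stokes
  equations and applications*, Acta Math. 203 (2009) 83–105 = arXiv:0709.3599v1: §3, Lemma 3.1
  with (3.17)–(3.18) and Remark 3.1, estimates (3.10)–(3.14); §4, (ii) (bounded weak solutions),
  Proposition 4.1, and the closing paragraph with (4.7)–(4.11); §5, proof of Theorem 5.2, first
  sentence. [KochNadirashviliSereginSverak2009]
* J. Serrin, *On the interior regularity of weak solutions of the Navier–Stokes equations*,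
  Arch. Rational Mech. Anal. 9 (1962) 187–195 — KNSS's reference [Serrin] for the bootstrap.
-/

noncomputable section

open MeasureTheory Set Function Filter TopologicalSpace InnerProductSpace
open scoped RealInnerProductSpace Laplacian ContDiff

namespace Literature.Analysis.FluidPDE

/-- **KNSS 2009, §4: regularity of bounded weak solutions of Navier–Stokes on a finite window
`ℝ³ × (0, T)`** (Acta Math. 203 (2009) = arXiv:0709.3599v1, §4, closing paragraph, estimates
(4.10) `‖∇ᵏₓu‖_{L^∞(ℝⁿ × (δ,T))} ≤ C(k, δ, T, M)` and (4.11)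
`‖∇ᵏₓ∂ₜ(u − b)‖_{L^∞(ℝⁿ × (δ,T))} ≤ C(k, δ, R, M)` (sic: the constant depends on
`k, δ, T, M`), `k = 0, 1, 2, …`, together with the
decomposition `u = v + w + b(t)` of Lemma 3.1, `‖b‖_{L^∞(0,T)} ≤ N = C₁(T)M² + C₂(T)M`, and the
vorticity equation (4.8) `ω_{i,t} − Δω_i = ∂_j(ω_j u_i − ω_i u_j)`, "satisfied in the sense of
distributions"; `n = 3`). **Statement.** For all `M` and `T > 0` there are constants
`C(k, δ), L(k, δ)` (`k ∈ ℕ`, `δ > 0`) and `N` such that every bounded weak solution `u` of the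
Navier–Stokes equations (`ν = 1`) in `ℝ³ × (0, T)` (`IsBoundedWeakNSSolutionOn (Ioo 0 T)`) with
`‖u(t, x)‖ ≤ M` on the window admits a jointly measurable `U : ℝ → ℝ³ → ℝ³` and a measurable
`b : ℝ → ℝ³` with `‖b(t)‖ ≤ N` for all `t`, such that: `u(t, ·) = U(t, ·) + b(t)` a.e. in `x` for
a.e. `t ∈ (0, T)`; every slice `U(t, ·)`, `0 < t < T`, is `C^∞` and divergence free; for every
`δ > 0` and every `k`, `‖∇ᵏₓU(t, x)‖ ≤ C(k, δ)` on `ℝ³ × (δ, T)` ((4.10)) and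
`‖∇ᵏₓU(t, x) − ∇ᵏₓU(s, x)‖ ≤ L(k, δ)|t − s|` for `s, t ∈ (δ, T)` ((4.11)); and `ω = curl U`
satisfies (4.8) with `u = U + b` in time-integrated form,
`ω(t, x) − ω(s, x) = ∫ₛᵗ (Δω(τ, ·)(x) − Dω(τ, ·)(x)[U(τ, x) + b(τ)] + DU(τ, ·)(x)[ω(τ, x)]) dτ`
for all `x` and `0 < s ≤ t < T`. This is the finite-window statement behind
`KNSS2009_regularity_boundedWeak_ancient` (same rendering; see the module docstring for the
choice of representatives and why every clause is implied by the printed estimates); it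
compresses Lemma 3.1, (3.10)–(3.14), Proposition 4.1 and the bootstrap (4.7)–(4.11), none of
which is in Mathlib or the tree. [cite: KochNadirashviliSereginSverak2009, §4 (4.8)–(4.11) with Lemma 3.1 (3.17)–(3.18) (arXiv:0709.3599v1 numbering)] -/
def KNSS2009_regularity_boundedWeak_window : Prop :=
  ∀ M T : ℝ, 0 < T →
    ∃ (C L : ℕ → ℝ → ℝ) (N : ℝ),
      ∀ ⦃u : ℝ → EuclideanSpace ℝ (Fin 3) → EuclideanSpace ℝ (Fin 3)⦄,
        IsBoundedWeakNSSolutionOn (Ioo 0 T) isOpen_Ioo 1 u →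
        (∀ t ∈ Ioo 0 T, ∀ x, ‖u t x‖ ≤ M) →
        ∃ (U : ℝ → EuclideanSpace ℝ (Fin 3) → EuclideanSpace ℝ (Fin 3))
          (b : ℝ → EuclideanSpace ℝ (Fin 3)),
          Measurable b ∧ (∀ t, ‖b t‖ ≤ N) ∧ Measurable (uncurry U) ∧
          (∀ᵐ t ∂((volume : Measure ℝ).restrict (Ioo 0 T)),
            u t =ᵐ[volume] fun x => U t x + b t) ∧
          (∀ t ∈ Ioo 0 T, ContDiff ℝ ∞ (U t)) ∧
          (∀ t ∈ Ioo 0 T, VectorCalculus.IsDivFree (U t)) ∧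
          (∀ δ : ℝ, 0 < δ → ∀ k : ℕ, ∀ t ∈ Ioo δ T, ∀ x,
            ‖iteratedFDeriv ℝ k (U t) x‖ ≤ C k δ) ∧
          (∀ δ : ℝ, 0 < δ → ∀ k : ℕ, ∀ s ∈ Ioo δ T, ∀ t ∈ Ioo δ T, ∀ x,
            ‖iteratedFDeriv ℝ k (U t) x - iteratedFDeriv ℝ k (U s) x‖ ≤ L k δ * |t - s|) ∧
          (∀ x, ∀ s t : ℝ, 0 < s → s ≤ t → t < T →
            curl (U t) x - curl (U s) x =
              ∫ τ in s..t, ((Δ (curl (U τ))) x - fderiv ℝ (curl (U τ)) x (U τ x + b τ) +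
                fderiv ℝ (U τ) x (curl (U τ) x)))

end Literature.Analysis.FluidPDE

end
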